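import Summits.CriticalPhenomena.PercolationContinuityZ3.Theorems.Transplant.SkelFrmQuasiBParamsFaceFloorsL2XA
import Summits.CriticalPhenomena.PercolationContinuityZ3.Theorems.Transplant.SkelFrmBParamsFaceFloorsL2XA
import Summits.CriticalPhenomena.PercolationContinuityZ3.Theorems.Transplant.SkelFrmQuasiBParamsFaceFloorsClrXA
import Summits.CriticalPhenomena.PercolationContinuityZ3.Theorems.Transplant.SkelFrmBParamsFaceFloorsClrXA
import Summits.CriticalPhenomena.PercolationContinuityZ3.Theorems.Transplant.SkelFrmQuasiBParamsFaceFloorsZXA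
import Summits.CriticalPhenomena.PercolationContinuityZ3.Theorems.Transplant.SkelFrmBParamsFaceFloorsZXA
import Summits.CriticalPhenomena.PercolationContinuityZ3.Theorems.Transplant.SkelFrmQuasiBParamsFaceCountsWX
import Summits.CriticalPhenomena.PercolationContinuityZ3.Theorems.Transplant.SkelFrmBParamsFaceCountsWX
import Summits.CriticalPhenomena.PercolationContinuityZ3.Theorems.Transplant.SkelFrmQuasiBParamsFaceCountsRangeA
import Summits.CriticalPhenomena.PercolationContinuityZ3.Theorems.Transplant.SkelFrmBParamsFaceCountsRangeA
import Summits.CriticalPhenomena.PercolationContinuityZ3.Theorems.Transplant.SkelFrmQuasiBChoiceWindow3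
import Summits.CriticalPhenomena.PercolationContinuityZ3.Theorems.Transplant.SkelFrmBChoiceWindow3
import Summits.CriticalPhenomena.PercolationContinuityZ3.Theorems.Transplant.PlanarSkeletonFrmQuasiDefs
import Summits.CriticalPhenomena.PercolationContinuityZ3.Theorems.Transplant.PlanarSkeletonFrmDefs
import Summits.CriticalPhenomena.PercolationContinuityZ3.Theorems.Transplant.SkelPhiStepIDataNS
import Summits.CriticalPhenomena.PercolationContinuityZ3.Theorems.Transplant.SkelFrmQuasi1SlotTypes
import HarnessLib
import Summits.CriticalPhenomena.PercolationContinuityZ3.Theorems.Transplant.SkelFrmBParamsFaceFloorsX2WA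
/-!
# GEN-Q PORT (WAVE-Q table v0.8 section 2, row G210, U-level L21; captain R-6/R-7 2026-08-27: carrier token swap `PlanarSkeletonFrmFrom ↦ PlanarSkeletonFrmQuasi`)
# of the tree module «Transplant/SkelFrmFromBParamsFaceFloorsX2WA» (sha256 2ac7aacc2c45f085…) onto the quasi-step carrier `PlanarSkeletonFrmQuasi` (p507026): «SkelFrmQuasiBParamsFaceFloorsX2WA»

HAND HUNK (L-FLOORMAP-1 ①⑥ / L-KitS-1 reader side; G017 «SkelFrmQuasiBChoiceNums», hp-8's KitSN): R'0×16 — the (S0) kit of record at window cost `KS.NQ Φ`.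

ORIGINAL TITLE: N2 (frames-only node, OPEN) — (F) value layer under (R-44)(c): **THE ONE-SIDED x-FACE FIELD LEMMAS** (hp-8 g43)

builds on p205010 (kernel theorem, internal audit signed; external expert review pending) — nothing in this file uses p205010; NOTHING is claimed about any open node
((N3-b), the end state).  Lane `prim-bschramm`, seat `prim-bschramm-stmt` (gen 33; GEN-Q column pen; tool = captain gen-1 g4's port_genq.py R-14 --cone + p3-g30's T1 patch).  Helper file (`--supports stmt-CriticalPhenomena-4575 --as helper`).
PORT RULES (U-wave r1–r4 re-used, GEN-Q hunk classes of p3-g29 #6136): declaration order, names and proof texts are those of «SkelFrmFromBParamsFaceFloorsX2WA», byte-identical except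
(i) the carrier token `PlanarSkeletonFrmFrom ↦ PlanarSkeletonFrmQuasi` in binders, `namespace`/`end` lines and qualified names (module names `SkelFrmFrom… ↦ SkelFrmQuasi…`
in imports of already-ported rows); (ii) `Φ.step ↦ Φ.qstep` with the called Steps lemma replaced by its `…Q`/`_q` twin and the cost `Φ.M` threaded (none in this file unless
listed below); (iii) `Φ.cyl_connected ↦ Φ.cyl_reach` readers (none unless listed); (iv) graph-ball radii / window floors ×`Φ.M` (none unless listed).  Carrier-free
residents stay imported/exported from the original «SkelFrmBParamsFaceFloorsX2WA» exactly as in the FrmFrom port.  Docstrings and citations are the original's.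

-/

noncomputable section

open scoped Classical

namespace Summit.CriticalPhenomena.PercolationContinuityZ3.Theorems.Transplant

namespace PlanarSkeletonFrmQuasi

namespace NegB

open Literature.Probability.Percolation Literature.Probability.LatticeModels SimpleGraph
open Literature.Probability.Percolation.KozmaNitzan.Cells (oth sgOf sgOf_sign)
open SkelConc (Consts)
open Skelφ (shearUnit shearUnit_pos crossOffX yCSLo yCSHi yCoreLoS yCoreHiS xBoxLoA)
open Skelφ.StepI (DataN)
open TwoAxis.Para (modulus)
open Neg

namespace KS

/-! ## §1 The one-sided window half-width and the count's range -/

section Window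

/-- **The one-sided landing tolerance of the x-face tangential run**: `bwX := 10·s₁` (= `small3 1 − 6·s₁`: the window of record minus the last core's
half-width-plus-slack consumed by `coreLo_env/coreHi_env`). [this work] -/
def bwX (κ : Consts) {V : Type} [DecidableEq V] [Countable V] {G : SimpleGraph V} [G.LocallyFinite] (Φ : PlanarSkeletonFrmQuasi G) (t : V) (p : unitInterval) (D : Skelφ.StepI.DataNS V) (g f : ℕ) : ℕ :=
  NegB.BSlot.small3 κ Φ t p D g f 1 - 6 * (fcellsA κ Φ t p D g f).s 1

/-- `bwX = small3 1 − 6·u₁A` in `ℤ` (the window numeral is read only through `NegB.small3_eq`; any window `≥ 7·s₁` serves). [folklore] -/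
theorem bwX_eq (κ : Consts) {V : Type} [DecidableEq V] [Countable V] {G : SimpleGraph V} [G.LocallyFinite] (Φ : PlanarSkeletonFrmQuasi G) (t : V) (p : unitInterval) (D : Skelφ.StepI.DataNS V) (g f : ℕ) :
    ((bwX κ Φ t p D g f : ℕ) : ℤ) = ((NegB.BSlot.small3 κ Φ t p D g f 1 : ℕ) : ℤ) - 6 * u₁A κ Φ t p D g f ∧ u₁A κ Φ t p D g f ≤ 2 * ((bwX κ Φ t p D g f : ℕ) : ℤ) := by
  have h6 : 6 * (fcellsA κ Φ t p D g f).s 1 ≤ NegB.BSlot.small3 κ Φ t p D g f 1 := by rw [(NegB.small3_eq κ Φ t p D g f).2]; omega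
  have h13 : 13 * (fcellsA κ Φ t p D g f).s 1 ≤ 2 * NegB.BSlot.small3 κ Φ t p D g f 1 := by rw [(NegB.small3_eq κ Φ t p D g f).2]; omega
  unfold bwX u₁A
  refine ⟨by push_cast [Nat.cast_sub h6]; ring, ?_⟩
  have : (((fcellsA κ Φ t p D g f).s 1 : ℕ) : ℤ) ≤ 2 * (((NegB.BSlot.small3 κ Φ t p D g f 1 - 6 * (fcellsA κ Φ t p D g f).s 1 : ℕ) : ℤ)) := by
    push_cast [Nat.cast_sub h6]
    have := (Int.ofNat_le).2 h13; push_cast at this; linarith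
  simpa using this

/-- **The one-sided count's range** `N3WX + 1 ≤ 240·Kq + 10` (from the budget of `N3WX_spec`: `u₁·(N+1) ≤ |T1X − F1cA| + 2u₁ ≤ kE + r₁ + C₁ + 2u₁`).
[folklore] -/
theorem N3WX_range (κ : Consts) {V : Type} [DecidableEq V] [Countable V] {G : SimpleGraph V} [G.LocallyFinite] (Φ : PlanarSkeletonFrmQuasi G) (t : V) (p : unitInterval) (D : Skelφ.StepI.DataNS V) (g : ℕ) (f : ℕ) (P : PCells2T) (hP : P.toPCells2 = fcellsA κ Φ t p D g f) (yL x : Site 2) (du : MDir) (hd : du.1 = 0) (z : Site 2) {kE C₁ : ℤ}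
    (hz : |z 1 - P.cenS x 1| ≤ kE) (hkE : kE ≤ 5 * (P.r 1 : ℤ)) (hC1 : |F1cA κ Φ t p D g f yL| ≤ C₁) (hC1' : C₁ ≤ 8 * u₁A κ Φ t p D g f)
    {bw : ℕ} (hbw : u₁A κ Φ t p D g f ≤ 2 * (bw : ℤ)) (hF : F1cA κ Φ t p D g f yL + u₁A κ Φ t p D g f ≤ T1X P x du z + bw) :
    N3WX κ Φ t p D g f P yL x du z bw + 1 ≤ 240 * Neg.Kq κ + 10 := by
  obtain ⟨r2, -, -⟩ := N3WX_spec κ Φ t p D g f P yL x du z hbw hF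
  obtain ⟨hr', -, -⟩ := cells_of_hP κ Φ t p D g f P hP
  have hu : 1 ≤ u₁A κ Φ t p D g f := (units_eqA κ Φ t p D g f).2.2.2.2.2
  have hr : (P.r 1 : ℤ) = 40 * (Neg.Kq κ : ℤ) * u₁A κ Φ t p D g f := by rw [hr' 1]; exact (units_eqA κ Φ t p D g f).2.2.2.1
  have hc0 : 0 ≤ P.c 0 := P.hc0 0
  have hc1 : P.c 0 ≤ (P.r 1 : ℤ) := by have h := P.hcr 0; rwa [show oth (0 : Fin 2) = 1 from rfl] at h
  set u := u₁A κ Φ t p D g f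
  set Q := (Neg.Kq κ : ℤ)
  have hstep := cenS_step_one P x du hd
  have hσ : |sgOf du * P.c 0| ≤ (P.r 1 : ℤ) := by
    rcases sgOf_sign du with h | h <;> rw [h] <;> simp [abs_le] <;> constructor <;> linarith
  have hT : |T1X P x du z - F1cA κ Φ t p D g f yL| ≤ kE + (P.r 1 : ℤ) + C₁ := by
    unfold T1X
    rw [hstep]
    calc |P.cenS x 1 + sgOf du * P.c 0 - z 1 - F1cA κ Φ t p D g f yL|
        = |-(z 1 - P.cenS x 1) + sgOf du * P.c 0 + -F1cA κ Φ t p D g f yL| := by ring_nf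
      _ ≤ |-(z 1 - P.cenS x 1) + sgOf du * P.c 0| + |-F1cA κ Φ t p D g f yL| := abs_add_le _ _
      _ ≤ |-(z 1 - P.cenS x 1)| + |sgOf du * P.c 0| + |-F1cA κ Φ t p D g f yL| := by linarith [abs_add_le (-(z 1 - P.cenS x 1)) (sgOf du * P.c 0)]
      _ ≤ kE + (P.r 1 : ℤ) + C₁ := by rw [abs_neg, abs_neg]; linarith
  have h1 : u * ((N3WX κ Φ t p D g f P yL x du z bw : ℤ) + 1) ≤ u * (240 * Q + 10) := by nlinarith
  have h2 : ((N3WX κ Φ t p D g f P yL x du z bw : ℤ) + 1) ≤ 240 * Q + 10 := le_of_mul_le_mul_left h1 (by linarith)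
  have h3 : ((N3WX κ Φ t p D g f P yL x du z bw + 1 : ℕ) : ℤ) ≤ ((240 * Neg.Kq κ + 10 : ℕ) : ℤ) := by push_cast; exact h2
  exact_mod_cast h3

/-- **The forward run's positions stay inside the transverse habitat** (one-sided twin of `tanX_pos_XA`): for `k ≤ N3WX`, `F′ + u₁·k` lies between
`−(5r₁ − 7 − c₀ − |z₁ − cenS₁|) + 5u₁ + 1` and `5r₁ − 7 − c₀ − |z₁ − cenS₁| − 5u₁ − 1` (`|F1cA| ≤ 6u₁`, `|F′ − F1cA| ≤ 2`, `2kE + 8u₁ + 8 + 2c₀ ≤ 5r₁`,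
`r₁ = 40Kq·u₁`; the run never passes the window's near edge by a stride, `mul_fwdCount_lt`). [folklore] -/
theorem tanX_pos_XW (κ : Consts) {V : Type} [DecidableEq V] [Countable V] {G : SimpleGraph V} [G.LocallyFinite] (Φ : PlanarSkeletonFrmQuasi G) (t : V) (p : unitInterval) (D : Skelφ.StepI.DataNS V) (g f : ℕ) (P : PCells2T) (yL x : Site 2) (du : MDir) (hd : du.1 = 0) (z : Site 2) {kE : ℤ} (hz : |z 1 - P.cenS x 1| ≤ kE)
    (hkE2 : 2 * kE + 8 * u₁A κ Φ t p D g f + 8 + 2 * (P.c 0 : ℤ) ≤ 5 * (P.r 1 : ℤ))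
    (hr1 : (P.r 1 : ℤ) = 40 * (Neg.Kq κ : ℤ) * u₁A κ Φ t p D g f) (hu : 1 ≤ u₁A κ Φ t p D g f) (hq1 : (1 : ℤ) ≤ Neg.Kq κ)
    (he1 : |F1cA κ Φ t p D g f yL| ≤ 6 * u₁A κ Φ t p D g f) (F' : ℤ) (hF' : |F' - F1cA κ Φ t p D g f yL| ≤ 2) (bw : ℕ) :
    ∀ k ≤ N3WX κ Φ t p D g f P yL x du z bw,
      -(5 * (P.r 1 : ℤ) - 4 - 3 - P.c 0 - |z 1 - P.cenS x 1|) + 5 * u₁A κ Φ t p D g f + 1 ≤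
          F' + 1 * u₁A κ Φ t p D g f * (k : ℤ) ∧
        F' + 1 * u₁A κ Φ t p D g f * (k : ℤ) + 5 * u₁A κ Φ t p D g f + 1 ≤
          5 * (P.r 1 : ℤ) - 4 - 3 - P.c 0 - |z 1 - P.cenS x 1| := by
  intro k hk
  set u := u₁A κ Φ t p D g f with hu_def
  have hun : ((u.toNat : ℕ) : ℤ) = u := Int.toNat_of_nonneg (by linarith)
  have hu0 : 0 < u.toNat := by omega
  -- the run does not pass the near edge by a stride: `F + u + u·N ≤ max (F + u) (T − bw + u − 1)`
  have up := Skelφ.mul_fwdCount_lt (T := T1X P x du z) (F := F1cA κ Φ t p D g f yL + u) (bw := bw) hu0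
  rw [hun] at up
  have hN : (N3WX κ Φ t p D g f P yL x du z bw : ℤ) = (Skelφ.fwdCount (T1X P x du z) (F1cA κ Φ t p D g f yL + u) u.toNat bw : ℤ) := rfl
  have hk' : (k : ℤ) ≤ (N3WX κ Φ t p D g f P yL x du z bw : ℤ) := by exact_mod_cast hk
  rw [hN] at hk'
  -- N2 (staggered): `T1X = (cenS x 1 − z 1) + σ·c 0`, so `|T1X| ≤ |z 1 − cenS x 1| + c 0`
  have hc0 : (0 : ℤ) ≤ P.c 0 := P.c_nonneg 0
  have hσ1 : |sgOf du| = 1 := by rcases sgOf_sign du with h | h <;> simp [h]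
  have hTle' : |T1X P x du z| ≤ |z 1 - P.cenS x 1| + P.c 0 := by
    have e : T1X P x du z = -(z 1 - P.cenS x 1) + sgOf du * P.c 0 := by unfold T1X; rw [cenS_step_one P x du hd]; ring
    rw [e]
    calc |-(z 1 - P.cenS x 1) + sgOf du * P.c 0| ≤ |-(z 1 - P.cenS x 1)| + |sgOf du * P.c 0| := abs_add_le _ _
      _ = |z 1 - P.cenS x 1| + P.c 0 := by rw [abs_neg, abs_mul, hσ1, one_mul, abs_of_nonneg hc0]
  have ha0 : 0 ≤ |z 1 - P.cenS x 1| := abs_nonneg _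
  obtain ⟨e1, e2⟩ := abs_le.1 he1
  obtain ⟨f1, f2⟩ := abs_le.1 hF'
  have hbw0 : (0 : ℤ) ≤ bw := Nat.cast_nonneg _
  generalize |z 1 - P.cenS x 1| = Az at hz hTle' ha0 ⊢
  generalize (P.c 0 : ℤ) = cc at hkE2 hc0 hTle' ⊢
  generalize T1X P x du z = T at up hTle' hk' ⊢
  generalize F1cA κ Φ t p D g f yL = F₀ at up e1 e2 f1 f2 hk' ⊢
  generalize (Skelφ.fwdCount T (F₀ + u) u.toNat bw : ℤ) = N at up hk'
  have hku : u * (k : ℤ) ≤ u * N := mul_le_mul_of_nonneg_left hk' (by linarith)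
  have hk0 : 0 ≤ u * (k : ℤ) := mul_nonneg (by linarith) (by positivity)
  have hTabs : -|T| ≤ T ∧ T ≤ |T| := ⟨neg_abs_le T, le_abs_self T⟩
  have hT0 : 0 ≤ |T| := abs_nonneg T
  rcases le_max_iff.1 up with h | h
  · constructor <;> nlinarith [hTabs.1, hTabs.2, hTle']
  · constructor <;> nlinarith [hTabs.1, hTabs.2, hTle']

end Window

/-! ## §2 The landing rows at the window of record with the one-sided tolerance -/

section Landing

/-- **`FL3` one-sided** (origin `yL`, `σT = 1`, core index `k` with `T1X − bwX ≤ F1cA + u₁k`): the last core's lower transverse end is inside the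
target box of half-width `small3 1 = 16·s₁`. [cite: KozmaNitzan2024, §4 Lemma 12 (pp. 23–25)] -/
theorem FL3_XW (κ : Consts) {V : Type} [DecidableEq V] [Countable V] {G : SimpleGraph V} [G.LocallyFinite] (Φ : PlanarSkeletonFrmQuasi G) (t : V) (p : unitInterval) (D : Skelφ.StepI.DataNS V) (g : ℕ) (f : ℕ) (mk : ℕ) (P : PCells2T) (hN : EqNumL κ Φ t p D g f) (hκ : (hL κ Φ t p D g f).natAbs ≤ 10 * nL κ Φ t p D g f) (hu2 : 2 ≤ u₁A κ Φ t p D g f) (x : Site 2) (du : MDir) (z : Site 2)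
    (yL : Site 2) (σ : ℤ) (Nr : ℕ) {k : ℕ}
    (hNT : T1X P x du z - bwX κ Φ t p D g f ≤ F1cA κ Φ t p D g f yL + 1 * u₁A κ Φ t p D g f * (k : ℤ))
    (hℓ : 11 * (2 * (k : ℤ) + ((k : ℤ) + 1000 * Neg.Kq κ) * (KS0.R'0N κ Φ (KS.NQ Φ) t p D mk : ℤ) + 8) ≤ 2 * (ℓL κ Φ t p D g f : ℤ)) :
    modulus (nL κ Φ t p D g f) (hL κ Φ t p D g f) (vL κ Φ t p D g f) (vβL κ Φ t p D g f) *
        (P.cenS (x + stepVec du) 1 - ((NegB.BSlot.small3 κ Φ t p D g f 1 : ℕ) : ℤ) + 2 - z 1 -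
          F1cA κ Φ t p D g f (yL + crossOffX (nL κ Φ t p D g f) (hL κ Φ t p D g f) (vL κ Φ t p D g f) σ 1 Nr)) ≤
      u₁A κ Φ t p D g f * ((shearUnit (nL κ Φ t p D g f) (hL κ Φ t p D g f) : ℤ) *
          (yCSLo (nL κ Φ t p D g f) (ℓL κ Φ t p D g f) (hL κ Φ t p D g f) (qB3XA κ Φ t p D g f (KS0.R'0N κ Φ (KS.NQ Φ) t p D mk)) (KS0.R'0N κ Φ (KS.NQ Φ) t p D mk) 1 k - 1)) -
        modulus (nL κ Φ t p D g f) (hL κ Φ t p D g f) (vL κ Φ t p D g f) (vβL κ Φ t p D g f) + 1 := by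
  obtain ⟨hn1, hℓ1⟩ := one_le_of_eqNumL κ Φ t p D g f hN
  have hm0 : 0 < modulus (nL κ Φ t p D g f) (hL κ Φ t p D g f) (vL κ Φ t p D g f) (vβL κ Φ t p D g f) := Skelφ.NegPrm.modulus_vβOf_pos hn1 hℓ1 _ _
  have hu : 1 ≤ u₁A κ Φ t p D g f := (units_eqA κ Φ t p D g f).2.2.2.2.2
  have hsh := F1cA_yTX0_sub_abs_le κ Φ t p D g f hN yL 1
  rw [F1cA_crossOffX]
  obtain ⟨s1, s2⟩ := abs_le.1 hsh
  obtain ⟨e1, -, -, -⟩ := yCS_eval κ Φ t p D g f hN (qB3XA κ Φ t p D g f (KS0.R'0N κ Φ (KS.NQ Φ) t p D mk)) (KS0.R'0N κ Φ (KS.NQ Φ) t p D mk) k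
  have hLo := coreLo_env κ Φ t p D g f mk hN hκ hu2 hℓ
  have hT1 : T1X P x du z = P.cenS (x + stepVec du) 1 - z 1 := rfl
  have hb := (NegB.small_eq κ Φ t p D g f).2
  have hbw := (bwX_eq κ Φ t p D g f).1
  have hbs : ((NegB.BSlot.small κ Φ t p D g f 1 : ℕ) : ℤ) = 8 * u₁A κ Φ t p D g f := by rw [hb]; unfold u₁A; push_cast; ring
  set m := modulus (nL κ Φ t p D g f) (hL κ Φ t p D g f) (vL κ Φ t p D g f) (vβL κ Φ t p D g f)
  set u := u₁A κ Φ t p D g f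
  set U : ℤ := (shearUnit (nL κ Φ t p D g f) (hL κ Φ t p D g f) : ℤ)
  set f₁ := F1cA κ Φ t p D g f (yTX0 κ Φ t p D g f yL 1)
  set F := F1cA κ Φ t p D g f yL
  set T := T1X P x du z
  set b₂ : ℤ := ((NegB.BSlot.small3 κ Φ t p D g f 1 : ℕ) : ℤ)
  have eT : P.cenS (x + stepVec du) 1 - b₂ + 2 - z 1 - f₁ = T - b₂ + 2 - f₁ := by rw [hT1]; ring
  rw [eT, e1]
  rw [hbs] at hLo
  rw [hbw, one_mul] at hNT
  have hf : T - f₁ ≤ u * k + (b₂ - 6 * u) + 2 := by linarith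
  have h1 : m * (T - b₂ + 2 - f₁) ≤ m * (u * k + 2 * u + 5 - 8 * u) - m := by
    have := mul_le_mul_of_nonneg_left (show T - b₂ + 2 - f₁ ≤ u * k + 2 * u + 4 - 8 * u by linarith) hm0.le
    linarith [this, show m * (u * k + 2 * u + 4 - 8 * u) = m * (u * k + 2 * u + 5 - 8 * u) - m by ring]
  nlinarith

/-- **`FL4` one-sided** (origin `yL`, `σT = 1`, core index `k` with `F1cA + u₁k ≤ T1X + bwX`): the last core's upper transverse end is inside the
target box of half-width `small3 1 = 16·s₁`. [cite: KozmaNitzan2024, §4 Lemma 12 (pp. 23–25)] -/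
theorem FL4_XW (κ : Consts) {V : Type} [DecidableEq V] [Countable V] {G : SimpleGraph V} [G.LocallyFinite] (Φ : PlanarSkeletonFrmQuasi G) (t : V) (p : unitInterval) (D : Skelφ.StepI.DataNS V) (g : ℕ) (f : ℕ) (mk : ℕ) (P : PCells2T) (hN : EqNumL κ Φ t p D g f) (hκ : (hL κ Φ t p D g f).natAbs ≤ 10 * nL κ Φ t p D g f) (hu2 : 2 ≤ u₁A κ Φ t p D g f) (x : Site 2) (du : MDir) (z : Site 2)
    (yL : Site 2) (σ : ℤ) (Nr : ℕ) {k : ℕ}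
    (hNT : F1cA κ Φ t p D g f yL + 1 * u₁A κ Φ t p D g f * (k : ℤ) ≤ T1X P x du z + bwX κ Φ t p D g f)
    (hℓ : 11 * (2 * (k : ℤ) + ((k : ℤ) + 1000 * Neg.Kq κ) * (KS0.R'0N κ Φ (KS.NQ Φ) t p D mk : ℤ) + 8) ≤ 2 * (ℓL κ Φ t p D g f : ℤ)) :
    modulus (nL κ Φ t p D g f) (hL κ Φ t p D g f) (vL κ Φ t p D g f) (vβL κ Φ t p D g f) *
          (F1cA κ Φ t p D g f (yL + crossOffX (nL κ Φ t p D g f) (hL κ Φ t p D g f) (vL κ Φ t p D g f) σ 1 Nr) + 1) +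
        u₁A κ Φ t p D g f * ((shearUnit (nL κ Φ t p D g f) (hL κ Φ t p D g f) : ℤ) *
            yCSHi (nL κ Φ t p D g f) (ℓL κ Φ t p D g f) (hL κ Φ t p D g f) (qB3XA κ Φ t p D g f (KS0.R'0N κ Φ (KS.NQ Φ) t p D mk)) (KS0.R'0N κ Φ (KS.NQ Φ) t p D mk) 1 k +
          shearUnit (nL κ Φ t p D g f) (hL κ Φ t p D g f) - 1) ≤
      modulus (nL κ Φ t p D g f) (hL κ Φ t p D g f) (vL κ Φ t p D g f) (vβL κ Φ t p D g f) *
        (P.cenS (x + stepVec du) 1 + ((NegB.BSlot.small3 κ Φ t p D g f 1 : ℕ) : ℤ) - 2 - z 1) := by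
  obtain ⟨hn1, hℓ1⟩ := one_le_of_eqNumL κ Φ t p D g f hN
  have hm0 : 0 < modulus (nL κ Φ t p D g f) (hL κ Φ t p D g f) (vL κ Φ t p D g f) (vβL κ Φ t p D g f) := Skelφ.NegPrm.modulus_vβOf_pos hn1 hℓ1 _ _
  have hu : 1 ≤ u₁A κ Φ t p D g f := (units_eqA κ Φ t p D g f).2.2.2.2.2
  have hsh := F1cA_yTX0_sub_abs_le κ Φ t p D g f hN yL 1
  rw [F1cA_crossOffX]
  obtain ⟨s1, s2⟩ := abs_le.1 hsh
  obtain ⟨-, e2, -, -⟩ := yCS_eval κ Φ t p D g f hN (qB3XA κ Φ t p D g f (KS0.R'0N κ Φ (KS.NQ Φ) t p D mk)) (KS0.R'0N κ Φ (KS.NQ Φ) t p D mk) k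
  have hHi := coreHi_env κ Φ t p D g f mk hN hκ hu2 hℓ
  have hT1 : T1X P x du z = P.cenS (x + stepVec du) 1 - z 1 := rfl
  have hb := (NegB.small_eq κ Φ t p D g f).2
  have hbw := (bwX_eq κ Φ t p D g f).1
  have hbs : ((NegB.BSlot.small κ Φ t p D g f 1 : ℕ) : ℤ) = 8 * u₁A κ Φ t p D g f := by rw [hb]; unfold u₁A; push_cast; ring
  set m := modulus (nL κ Φ t p D g f) (hL κ Φ t p D g f) (vL κ Φ t p D g f) (vβL κ Φ t p D g f)
  set u := u₁A κ Φ t p D g f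
  set U : ℤ := (shearUnit (nL κ Φ t p D g f) (hL κ Φ t p D g f) : ℤ)
  set f₁ := F1cA κ Φ t p D g f (yTX0 κ Φ t p D g f yL 1)
  set F := F1cA κ Φ t p D g f yL
  set T := T1X P x du z
  set b₂ : ℤ := ((NegB.BSlot.small3 κ Φ t p D g f 1 : ℕ) : ℤ)
  have eT : P.cenS (x + stepVec du) 1 + b₂ - 2 - z 1 = T + b₂ - 2 := by rw [hT1]; ring
  rw [eT, e2]
  rw [hbs] at hHi
  rw [hbw, one_mul] at hNT
  have hf : f₁ ≤ T - u * k + (b₂ - 6 * u) + 2 := by linarith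
  have h1 : m * (f₁ + 1) ≤ m * (T - u * k + (b₂ - 6 * u) + 3) := mul_le_mul_of_nonneg_left (by linarith) hm0.le
  have h2 : m * (u * k + 8 * u - 2 * u - 5) + m * (T - u * k + (b₂ - 6 * u) + 3) = m * (T + b₂ - 2) := by ring
  nlinarith

end Landing

/-! ## §3 Two more pinned fields re-stated for the one-sided assembly -/

section More

/-- (R-44)(c) GENERIC TWIN (any tangential sign `σT`; hp-8 g43) of **`hclr_XA`** (SkelFrmBParamsFaceFloorsClrXA): the along x-run never dips into the
seed box. [cite: KozmaNitzan2024, §4 Lemma 12 (pp. 23–25)] -/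
theorem hclr_XA_gen (κ : Consts) {V : Type} [DecidableEq V] [Countable V] {G : SimpleGraph V} [G.LocallyFinite] (Φ : PlanarSkeletonFrmQuasi G) (t : V) (p : unitInterval) (D : Skelφ.StepI.DataNS V) (mk : ℕ) (g : ℕ) (f : ℕ) (P : PCells2T) (hnA : 2000 * Neg.Kq κ * (KS0.R'0N κ Φ (KS.NQ Φ) t p D mk + 2) ≤ nL κ Φ t p D g f) (x : Site 2) (du : MDir) (z : Site 2) (yL : Site 2) (qB : ℕ)
    (hyL : ((Mu D : ℕ) : ℤ) < sgOf du * yL 0 - (qB : ℤ) - (KS0.R'0N κ Φ (KS.NQ Φ) t p D mk : ℤ) - (nL κ Φ t p D g f : ℤ)) (σT : ℤ) :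
    ∀ k ≤ (NrX κ Φ t p D g f P yL σT x du z), ((Mu D : ℕ) : ℤ) < xBoxLoA (nL κ Φ t p D g f) qB (KS0.R'0N κ Φ (KS.NQ Φ) t p D mk) k + sgOf du * yL 0 := by
  intro k _
  have hRn : KS0.R'0N κ Φ (KS.NQ Φ) t p D mk ≤ nL κ Φ t p D g f := by
    have : KS0.R'0N κ Φ (KS.NQ Φ) t p D mk ≤ 2000 * Neg.Kq κ * (KS0.R'0N κ Φ (KS.NQ Φ) t p D mk + 2) := by have := Neg.one_le_Kq κ; nlinarith
    omega
  exact clr_hclrX_of_zero hRn (by linarith) k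

/-- **`hZfar` at the window of record `small3`** (x-face; any window `≤ 3r₀`, `NegB.small3_le`): `lev + kF₀A + 1 < 20r₀ − small3 0` (`lev ≤ 15r₀ − 1 + E`,
`kF₀A ≤ 8u₀ + 1`, `5r₀ = 200·Kq·u₀`). [cite: KozmaNitzan2024, §4 Lemma 12 (pp. 23–25)] -/
theorem hZfar_XW (κ : Consts) {V : Type} [DecidableEq V] [Countable V] {G : SimpleGraph V} [G.LocallyFinite] (Φ : PlanarSkeletonFrmQuasi G) (t : V) (p : unitInterval) (D : Skelφ.StepI.DataNS V) (c : ℕ) (mk : ℕ) (g : ℕ) (f : ℕ) (P : PCells2T) (hP : P.toPCells2 = fcellsA κ Φ t p D g f) (x : Site 2) (du : MDir) (hd : du.1 = 0) (j : ℕ) (hj : j < P.K) (z : Site 2) {E : ℕ}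
    (hlev2 : P.lev du x z ≤ P.faceL 0 j + E) (hEu : (E : ℤ) ≤ u₀A κ Φ t p D g f)
    (hkF0 : kF₀A κ Φ t p D c mk g f ≤ 8 * u₀A κ Φ t p D g f + 1) :
    P.lev du x z + ((fun i : Fin 2 => if i = 0 then kF₀A κ Φ t p D c mk g f else kF₁A κ Φ t p D c mk g f) du.1) + 1 < 20 * (P.r du.1 : ℤ) - ((NegB.BSlot.small3 κ Φ t p D g f du.1 : ℕ) : ℤ) := by
  rw [hd]
  simp only [if_true]
  obtain ⟨-, f2⟩ := faceL_bounds κ Φ t p D g f P hP j hj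
  have hr : (P.r 0 : ℤ) = 40 * (Neg.Kq κ : ℤ) * u₀A κ Φ t p D g f := by rw [(cells_of_hP κ Φ t p D g f P hP).1 0]; exact (units_eqA κ Φ t p D g f).2.2.1
  have hb : ((NegB.BSlot.small3 κ Φ t p D g f 0 : ℕ) : ℤ) ≤ 3 * (P.r 0 : ℤ) := by
    rw [(cells_of_hP κ Φ t p D g f P hP).1 0]; exact_mod_cast NegB.small3_le κ Φ t p D g f 0
  have hq : (1 : ℤ) ≤ Neg.Kq κ := by exact_mod_cast Neg.one_le_Kq κ
  have hu : 1 ≤ u₀A κ Φ t p D g f := (units_eqA κ Φ t p D g f).2.2.2.2.1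
  have hQu : u₀A κ Φ t p D g f ≤ (Neg.Kq κ : ℤ) * u₀A κ Φ t p D g f := le_mul_of_one_le_left (by linarith) hq
  linarith

end More

end KS

end NegB

end PlanarSkeletonFrmQuasi

end Summit.CriticalPhenomena.PercolationContinuityZ3.Theorems.Transplant

end
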